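import Summits.RiemannHypothesis.RiemannHypothesis.Theorems.PfPersistenceDefectiveTransportShape
import HarnessLib

/-!
# PF persistence campaign (cell `pub-rhpf`, leaf G1.22 TRANSPORT-1, gen 9): the transport kernel of
record, part 9b — the SECTOR CLOCK DICTIONARIES of the shape face

Honest framing (verbatim, applies to every line): mechanism/rigidity campaign; no RH claims.

Part 8 §3 proved, for the parity-free bottom `ε = weilGroundEnergy`, that convexity of the clock
function `t ↦ ε (log t / κ)` on a half-line (`κ > 0`) is a floor of rate `κ`, hence confines every
nontrivial zero to `|Re ρ − 1/2| ≤ κ/2` (content only for `κ < 1`).  This part records the same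
dictionary for the two SECTOR bottoms `ε_od = weilOddGroundEnergy`, `ε_ev = weilEvenGroundEnergy`,
through the sector floor-rate dictionaries `abs_re_sub_half_le_of_{odd,even}_floor_eventually` /
`quasiRiemannHypothesis_of_{odd,even}_floor` (`PfPersistenceFloorRate{Odd,}`):

* `floor_of_convexOn_clock'` — part 8 `floor_of_convexOn_clock` for an arbitrary `F : ℝ → ℝ`;
* `strip_of_convexOn_clock_{odd,even}`, `quasiRiemannHypothesis_of_convexOn_clock_{odd,even}`,
  `not_convexOn_clock_{odd,even}_of_offline_zero` (Ω-forms).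

Every convexity clause is a HYPOTHESIS — no real `κ` is asserted to satisfy it; no reach number;
nothing here is a step toward RH.  (Part 9, `PfPersistenceDefectiveTransportShapeSector`, has the
concavity side and the RH-free exclusions of the sector cells.)

References: E. Bombieri, Rend. Mat. Acc. Lincei (9) 11 (2000) §4; secant inequalities [folklore].
-/

noncomputable section

set_option linter.dupNamespace false

namespace Summit.RiemannHypothesis.RiemannHypothesis.Theorems.PfPersistenceDefectiveTransport

open Set
open _root_.Literature.NumberTheory.LFunctions
open _root_.Summit.RiemannHypothesis.RiemannHypothesis.Theorems.PfPersistenceFloorRate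
  (abs_re_sub_half_le_of_even_floor_eventually quasiRiemannHypothesis_of_even_floor)
open _root_.Summit.RiemannHypothesis.RiemannHypothesis.Theorems.PfPersistenceFloorRateOdd
  (abs_re_sub_half_le_of_odd_floor_eventually quasiRiemannHypothesis_of_odd_floor)

/-! ## §1 The clock floor for an arbitrary function -/

/-- **Convexity against the clock `e^{κ a}` gives a floor of rate `κ`, for any `F`** (part 8
`floor_of_convexOn_clock` made abstract). RH-free. [folklore] -/
theorem floor_of_convexOn_clock' {F : ℝ → ℝ} {κ t₀ : ℝ} (hκ : 0 < κ) (ht₀ : 0 < t₀)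
    (hconv : ConvexOn ℝ (Ici t₀) (fun t : ℝ => F (Real.log t / κ))) :
    ∃ K a₀ : ℝ, ∀ a : ℝ, a₀ ≤ a → -(K * Real.exp (κ * a)) ≤ F a := by
  set g : ℝ → ℝ := fun t : ℝ => F (Real.log t / κ) with hg
  refine ⟨max (-g (t₀ + 1)) 0 + max (g t₀ - g (t₀ + 1)) 0, Real.log (t₀ + 1) / κ, fun a ha ↦ ?_⟩
  have hM : 0 ≤ max (g t₀ - g (t₀ + 1)) 0 := le_max_right _ _
  have ha' : Real.log (t₀ + 1) ≤ κ * a := by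
    have := (div_le_iff₀ hκ).1 ha
    linarith [mul_comm a κ]
  have ht : t₀ + 1 ≤ Real.exp (κ * a) := by
    calc t₀ + 1 = Real.exp (Real.log (t₀ + 1)) := (Real.exp_log (by linarith)).symm
      _ ≤ Real.exp (κ * a) := Real.exp_le_exp.2 ha'
  have he1 : 1 ≤ Real.exp (κ * a) := by
    have h0 : 0 ≤ Real.log (t₀ + 1) := Real.log_nonneg (by linarith)
    exact Real.one_le_exp (h0.trans ha')
  have hfloor := linearFloor_of_convexOn (f := g) (by linarith) hconv (Real.exp (κ * a)) ht
  have hga : g (Real.exp (κ * a)) = F a := by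
    simp only [hg, Real.log_exp, mul_div_cancel_left₀ a hκ.ne']
  rw [hga] at hfloor
  have h3 : -g (t₀ + 1) ≤ max (-g (t₀ + 1)) 0 * Real.exp (κ * a) :=
    (le_max_left _ _).trans (le_mul_of_one_le_right (le_max_right _ _) he1)
  have e : (max (-g (t₀ + 1)) 0 + max (g t₀ - g (t₀ + 1)) 0) * Real.exp (κ * a)
      = max (-g (t₀ + 1)) 0 * Real.exp (κ * a)
        + max (g t₀ - g (t₀ + 1)) 0 * Real.exp (κ * a) := by ring
  linarith

/-! ## §2 The sector clock dictionaries: clock-`κ` convexity confines the zeros to `κ/2` -/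

/-- **Odd shape thermometer.**  Convexity of `t ↦ ε_od (log t / κ)` on `[t₀, ∞)` (`κ > 0`,
`t₀ > 0`) ⟹ floor of rate `κ` (§1) ⟹ `|Re ρ − 1/2| ≤ κ/2` for every nontrivial zero
(`abs_re_sub_half_le_of_odd_floor_eventually`).  Content only for `κ < 1`.  CONDITIONAL (shape
hypothesis, not claimed); proof.conditional; no RH claim. [folklore] -/
theorem strip_of_convexOn_clock_odd {κ t₀ : ℝ} (hκ : 0 < κ) (ht₀ : 0 < t₀)
    (hconv : ConvexOn ℝ (Ici t₀) (fun t : ℝ => weilOddGroundEnergy (Real.log t / κ)))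
    {ρ : ℂ} (hρ : ρ ∈ ZetaZeros.riemannZetaNontrivialZeros) : |ρ.re - 1 / 2| ≤ κ / 2 := by
  obtain ⟨K, a₀, h⟩ := floor_of_convexOn_clock' hκ ht₀ hconv
  exact abs_re_sub_half_le_of_odd_floor_eventually hκ.le h hρ

/-- Quasi-RH form of the odd shape thermometer. CONDITIONAL; proof.conditional; no RH claim.
[folklore] -/
theorem quasiRiemannHypothesis_of_convexOn_clock_odd {κ t₀ : ℝ} (hκ : 0 < κ) (ht₀ : 0 < t₀)
    (hconv : ConvexOn ℝ (Ici t₀) (fun t : ℝ => weilOddGroundEnergy (Real.log t / κ))) :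
    QuasiRiemannHypothesis (1 / 2 + κ / 2) := by
  obtain ⟨K, a₀, h⟩ := floor_of_convexOn_clock' hκ ht₀ hconv
  exact quasiRiemannHypothesis_of_odd_floor hκ.le h

/-- **Ω-form, odd sector.**  A zero with `|Re ρ − 1/2| > κ/2` forbids convexity of `ε_od` against
the clock `e^{κ a}` on every half-line.  RH-free implication; no RH claim. [folklore] -/
theorem not_convexOn_clock_odd_of_offline_zero {ρ : ℂ}
    (hρ : ρ ∈ ZetaZeros.riemannZetaNontrivialZeros) {κ : ℝ} (hκ : 0 < κ)
    (hfar : κ / 2 < |ρ.re - 1 / 2|) {t₀ : ℝ} (ht₀ : 0 < t₀) :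
    ¬ ConvexOn ℝ (Ici t₀) (fun t : ℝ => weilOddGroundEnergy (Real.log t / κ)) :=
  fun h ↦ (not_le.2 hfar) (strip_of_convexOn_clock_odd hκ ht₀ h hρ)

/-- **Even shape thermometer.**  Convexity of `t ↦ ε_ev (log t / κ)` on `[t₀, ∞)` (`κ > 0`,
`t₀ > 0`) ⟹ `|Re ρ − 1/2| ≤ κ/2` (`abs_re_sub_half_le_of_even_floor_eventually`).  CONDITIONAL;
proof.conditional; no RH claim. [folklore] -/
theorem strip_of_convexOn_clock_even {κ t₀ : ℝ} (hκ : 0 < κ) (ht₀ : 0 < t₀)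
    (hconv : ConvexOn ℝ (Ici t₀) (fun t : ℝ => weilEvenGroundEnergy (Real.log t / κ)))
    {ρ : ℂ} (hρ : ρ ∈ ZetaZeros.riemannZetaNontrivialZeros) : |ρ.re - 1 / 2| ≤ κ / 2 := by
  obtain ⟨K, a₀, h⟩ := floor_of_convexOn_clock' hκ ht₀ hconv
  exact abs_re_sub_half_le_of_even_floor_eventually hκ.le h hρ

/-- Quasi-RH form of the even shape thermometer. CONDITIONAL; proof.conditional; no RH claim.
[folklore] -/
theorem quasiRiemannHypothesis_of_convexOn_clock_even {κ t₀ : ℝ} (hκ : 0 < κ) (ht₀ : 0 < t₀)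
    (hconv : ConvexOn ℝ (Ici t₀) (fun t : ℝ => weilEvenGroundEnergy (Real.log t / κ))) :
    QuasiRiemannHypothesis (1 / 2 + κ / 2) := by
  obtain ⟨K, a₀, h⟩ := floor_of_convexOn_clock' hκ ht₀ hconv
  exact quasiRiemannHypothesis_of_even_floor hκ.le h

/-- **Ω-form, even sector.**  RH-free implication; no RH claim. [folklore] -/
theorem not_convexOn_clock_even_of_offline_zero {ρ : ℂ}
    (hρ : ρ ∈ ZetaZeros.riemannZetaNontrivialZeros) {κ : ℝ} (hκ : 0 < κ)
    (hfar : κ / 2 < |ρ.re - 1 / 2|) {t₀ : ℝ} (ht₀ : 0 < t₀) :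
    ¬ ConvexOn ℝ (Ici t₀) (fun t : ℝ => weilEvenGroundEnergy (Real.log t / κ)) :=
  fun h ↦ (not_le.2 hfar) (strip_of_convexOn_clock_even hκ ht₀ h hρ)

end Summit.RiemannHypothesis.RiemannHypothesis.Theorems.PfPersistenceDefectiveTransport

end
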